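import Summits.BirchSwinnertonDyer.Rank1Residual.X11b.AnticyclotomicControlMap
import Literature.NumberTheory.EllipticCurves.GeomPointsGaloisModule
import Literature.NumberTheory.GaloisRepresentations.LocalGlobalCohomology
import HarnessLib

/-!
# X11b, route R1 — local triviality at a decomposition group `D_v ≤ Γ_K` versus in `H¹(K_v, M)`:
# the bridge between the `GreenbergSelmer` vocabulary and the Poitou–Tate vocabulary

HONEST FRAMING (cell `b2b-bsdres`, run/shared/lean/b2b/bsd-rank1-residual/, verbatim in every
file): the goal of the cell is to DELETE the COMBINATION-SHAPED residual classes of the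
Birch–Swinnerton-Dyer formula for ALL analytic-rank `≤ 1` elliptic curves over `ℚ` — "full BSD
formula for every rank `≤ 1` curve in class `C`" assembled STRICTLY from published theorems — so
that the rank-`≤ 1` remainder becomes exactly the CONSTRUCTION-SHAPED classes, which are TYPED
(missing-input `Prop`s), NOT attempted. This is not "finishing BSD". Sub-cell
`b2b-bsdres-multr1-p1` (X11b, route R1 = Castella 2018 Thm. A re-proved along the author's
erratum); a RESEARCH ROUTE; no claim beyond the stated class; X11b stays CONSTRUCTION-SHAPED;
nothing here changes a label; no named fact is minted (definitions with bodies — a discrete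
Galois module packaging and an identity isomorphism — and theorems; no `sorry`).

## Why

The three Poitou–Tate atoms of Cas18 Thm. 2.3 on route R1's objects — (P6) `BaseSelmerCountAt`,
(P9) `LocSurjAt`, (L10) `CoinvariantsTrivialAt` (`AnticyclotomicControlAtoms`) — are statements
about Castella's Selmer group over `K`, `selmerAcBase W p 𝔭 Σ = selmerOver ⊤ E[p^∞] p 𝔭 Σ`, a
subgroup of `H¹(⊤, E[p^∞])` cut out by LOCAL TRIVIALITY AT DECOMPOSITION GROUPS `D_v ≤ Γ_K`
(`GreenbergSelmer.awayKer`, `infKer`, `LocalDatum.strictKer`; Greenberg 1989 p. 98: "choose a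
place of `ℚ̄` over `v` and let `D_v` denote the decomposition group").  The Poitou–Tate layer of
the tree (`Literature.NumberTheory.GaloisCohomology.poitouTate_selmerStructure_duality`, Howard
2004 Thm. 2.1.11; the counting form `PoitouTateSelmerCounting`) speaks of Selmer structures
`𝓛_v ≤ H¹(K_v, M) := H¹(Γ_{K_v}, M)` for the COMPLETION `K_v` (`DiscreteGaloisModule.SelmerStructure`,
`galoisCohomology.localization`).  The two local groups are related by the continuous surjection
`Γ_{K_v} ↠ D_v` (`absGaloisRestrict K K_v`; `GreenbergSelmer.decomp v` IS its range), which is NOT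
known to be injective in the tree (Krasner).  This file proves that this does not matter for
LOCAL TRIVIALITY: a class of `H¹(K, M)` dies on `D_v` iff it dies in `H¹(K_v, M)` — inflation along
a surjection is injective on `H¹`, an elementary statement on continuous crossed homomorphisms.
The companion `AnticyclotomicSelmerStructure` concludes that Castella's Selmer group over `K` is
the Selmer group of an explicit Selmer structure.

## What is here (all kernel theorems; two definitions with bodies)

* `LocBridge.map_oneCocycleClass_eq_zero_iff` — for a compatible pair `(θ : L → G, f)` with `f`
  BIJECTIVE on the coefficients, `[f ∘ φ ∘ θ] = 0` in `H¹(L, Y)` iff `φ` is principal ON THE RANGE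
  of `θ`: `∃ x, ∀ l, φ(θ l) = θ l • x − x` (Mathlib `continuousCohomology 1`, any `TopRep`s).
* `LocBridge.resH1Hom_oneCocycleClass_eq_zero_iff`, `LocBridge.resH1Hom_eq_zero_iff_of_range_eq`,
  `LocBridge.map_eq_zero_iff_resSubgroup_range`, `LocBridge.resSubgroup_eq_zero_iff_of_coe_eq` — the
  discrete-module forms: the kernel of the map of a pair `(θ, ψ)` with `ψ` bijective depends only on
  `range θ`; it is the kernel of restriction to the subgroup `range θ ≤ G` (`ResKernel.resSubgroup`).
* `LocBridge.ofSMul M hM : DiscreteGaloisModule K M` — the discrete `Γ_K`-module structure of a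
  `DistribMulAction` with open stabilisers; `galoisCohomology (ofSMul M hM) 1 = discreteH1 Γ_K M`
  and `W.torsionGaloisModule n = ofSMul E[n] _` DEFINITIONALLY; `LocBridge.toDiscreteH1 hM` the
  identity isomorphism between the two types; `LocBridge.primaryGaloisModule W p = ofSMul E[p^∞] _`.
* **`LocBridge.localization_inr_eq_zero_iff` / `…_inl_…` — `loc_v c = 0` in `H¹(K_v, M)` iff
  `res_{D_v} c = 0`** (finite and infinite places).

References: [Greenberg1989] §1 p. 98; [GreenbergLNM1716] §2 ("one can identify `G_{M_η}` with …
the decomposition subgroup for some prime of `F̄` lying over `η`"); Serre, *Galois Cohomology*,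
I.§2.4, I.§5.1 (principal crossed homomorphisms), II.§1.1.
-/

noncomputable section

open scoped Classical

open CategoryTheory NumberField IsDedekindDomain Field
open Literature.NumberTheory.EllipticCurves Literature.NumberTheory.EllipticCurves.GreenbergSelmer
open Literature.NumberTheory.GaloisRepresentations

universe u

/-! ## §1. Principal-on-the-range criterion for the map of a compatible pair -/

namespace Summit.BirchSwinnertonDyer.Rank1Residual.X11b.LocBridge

section TopRepLevel

variable {G L : Type u} [Group G] [TopologicalSpace G] [IsTopologicalGroup G]
  [Group L] [TopologicalSpace L] [IsTopologicalGroup L]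

/-- **`[f ∘ φ ∘ θ] = 0 ↔ φ` is principal on `range θ`.**  For a continuous homomorphism
`θ : L → G`, topological representations `X` of `G` and `Y` of `L`, and a morphism
`f : res_θ X ⟶ Y` which is BIJECTIVE on the underlying modules, the class of the pulled-back
crossed homomorphism `f ∘ φ ∘ θ` vanishes in `H¹_cont(L, Y)` iff there is `x ∈ X` with
`φ(θ l) = θ l • x − x` for all `l ∈ L`.  (`⟸` needs nothing; `⟹`: a principal cocycle
`l ↦ l • y − y` with `y = f x` is `f (θ l • x − x)`, and `f` is injective.)  "Inflation along a
surjection is injective on `H¹`" is the case `range θ = G`.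
Serre, *Galois Cohomology*, I.§2.4 and I.§5.1. [folklore] -/
theorem map_oneCocycleClass_eq_zero_iff (X : TopRep.{u} ℤ G) (Y : TopRep.{u} ℤ L) (θ : L →ₜ* G)
    (f : TopRep.res (θ : L →* G) X ⟶ Y) (hf : Function.Bijective f.hom)
    (φ : contOneCocycles X) :
    ContinuousCohomology.map θ f 1 (oneCocycleClass X φ) = 0 ↔
      ∃ x : X, ∀ l : L, φ.1 (θ l) = X.ρ (θ l) x - x := by
  rw [map_oneCocycleClass, oneCocycleClass_eq_zero_iff]
  constructor
  · rintro ⟨y, hy⟩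
    obtain ⟨x, rfl⟩ := hf.2 y
    refine ⟨x, fun l ↦ hf.1 ?_⟩
    have h := hy l
    rw [contOneCocycles.pullback_apply] at h
    rw [h, map_sub, ← TopRep.hom_comm_apply f l x]
    rfl
  · rintro ⟨x, hx⟩
    refine ⟨f.hom x, fun l ↦ ?_⟩
    rw [contOneCocycles.pullback_apply, hx, map_sub, ← TopRep.hom_comm_apply f l x]
    rfl

end TopRepLevel

section Discrete

variable {G : Type u} [Group G] [TopologicalSpace G] [IsTopologicalGroup G]
variable {M : Type u} [AddCommGroup M] [DistribMulAction G M] [TopologicalSpace M]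
  [DiscreteTopology M]
variable {L : Type u} [Group L] [TopologicalSpace L] [IsTopologicalGroup L]
variable {N : Type u} [AddCommGroup N] [DistribMulAction L N] [TopologicalSpace N]
  [DiscreteTopology N]
variable {L' : Type u} [Group L'] [TopologicalSpace L'] [IsTopologicalGroup L']
variable {N' : Type u} [AddCommGroup N'] [DistribMulAction L' N'] [TopologicalSpace N']
  [DiscreteTopology N']

/-- Discrete-module form of `map_oneCocycleClass_eq_zero_iff`: for a compatible pair
`(θ : L → G, ψ : M → N)` with `ψ` bijective, `res_{(θ,ψ)} [φ] = 0` iff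
`∃ x, ∀ l, φ(θ l) = θ l • x − x`. Serre, *Galois Cohomology*, I.§2.4 and I.§5.1. [folklore] -/
theorem resH1Hom_oneCocycleClass_eq_zero_iff (θ : L →ₜ* G) (ψ : M →+ N)
    (h : ∀ (l : L) (m : M), ψ (θ l • m) = l • ψ m) (hψ : Function.Bijective ψ)
    (φ : contOneCocycles (discreteTopRep G M)) :
    resH1Hom θ ψ h (oneCocycleClass _ φ) = 0 ↔ ∃ x : M, ∀ l : L, φ.1 (θ l) = θ l • x - x :=
  map_oneCocycleClass_eq_zero_iff (discreteTopRep G M) (discreteTopRep L N) θ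
    (resHomOfEquivariant θ ψ h) hψ φ

/-- **The kernel of the map of a pair `(θ, ψ)` with `ψ` bijective depends only on `range θ`.**
For two compatible pairs `(θ₁ : L → G, ψ₁)`, `(θ₂ : L' → G, ψ₂)` with bijective coefficient maps and
`range θ₁ = range θ₂`, a class of `H¹_cont(G, M)` dies under one iff it dies under the other.
Serre, *Galois Cohomology*, I.§2.4 and I.§5.1. [folklore] -/
theorem resH1Hom_eq_zero_iff_of_range_eq (θ₁ : L →ₜ* G) (ψ₁ : M →+ N)
    (h₁ : ∀ (l : L) (m : M), ψ₁ (θ₁ l • m) = l • ψ₁ m) (hψ₁ : Function.Bijective ψ₁)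
    (θ₂ : L' →ₜ* G) (ψ₂ : M →+ N')
    (h₂ : ∀ (l : L') (m : M), ψ₂ (θ₂ l • m) = l • ψ₂ m) (hψ₂ : Function.Bijective ψ₂)
    (hrange : Set.range θ₁ = Set.range θ₂) (c : discreteH1 G M) :
    resH1Hom θ₁ ψ₁ h₁ c = 0 ↔ resH1Hom θ₂ ψ₂ h₂ c = 0 := by
  obtain ⟨φ, rfl⟩ := oneCocycleClass_surjective _ c
  rw [resH1Hom_oneCocycleClass_eq_zero_iff θ₁ ψ₁ h₁ hψ₁,
    resH1Hom_oneCocycleClass_eq_zero_iff θ₂ ψ₂ h₂ hψ₂]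
  constructor
  · rintro ⟨x, hx⟩
    refine ⟨x, fun l ↦ ?_⟩
    obtain ⟨l₁, hl₁⟩ : θ₂ l ∈ Set.range θ₁ := hrange ▸ Set.mem_range_self l
    rw [← hl₁, hx]
  · rintro ⟨x, hx⟩
    refine ⟨x, fun l ↦ ?_⟩
    obtain ⟨l₂, hl₂⟩ : θ₁ l ∈ Set.range θ₂ := hrange.symm ▸ Set.mem_range_self l
    rw [← hl₂, hx]

/-- Restriction to a subgroup `D ≤ G` (`ResKernel.resSubgroup`) kills `[φ]` iff `φ` is principal on
`D`. Serre, *Galois Cohomology*, I.§2.5 and I.§5.1. [folklore] -/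
theorem resSubgroup_oneCocycleClass_eq_zero_iff (D : Subgroup G)
    (φ : contOneCocycles (discreteTopRep G M)) :
    ResKernel.resSubgroup D M (oneCocycleClass _ φ) = 0 ↔
      ∃ x : M, ∀ d : G, d ∈ D → φ.1 d = d • x - x := by
  rw [ResKernel.resSubgroup, resH1Hom_oneCocycleClass_eq_zero_iff (subgroupIncl D)
    (AddMonoidHom.id M) (fun _ _ ↦ rfl) Function.bijective_id]
  exact ⟨fun ⟨x, hx⟩ ↦ ⟨x, fun d hd ↦ hx ⟨d, hd⟩⟩, fun ⟨x, hx⟩ ↦ ⟨x, fun d ↦ hx d d.2⟩⟩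

/-- **Mixed form: a `TopRep`-level pull-back along `θ` (bijective on coefficients) kills a class of
`H¹_cont(G, M)` iff restriction to the subgroup `range θ ≤ G` kills it.**  This is the shape in which
the two libraries meet: `galoisCohomology.localization` is such a pull-back along
`absGaloisRestrict K K_v`, whose range is `GreenbergSelmer.decomp v`.
Serre, *Galois Cohomology*, I.§2.4–2.5 and I.§5.1. [folklore] -/
theorem map_eq_zero_iff_resSubgroup_range (θ : L →ₜ* G) (Y : TopRep.{u} ℤ L)
    (f : TopRep.res (θ : L →* G) (discreteTopRep G M) ⟶ Y) (hf : Function.Bijective f.hom)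
    (c : discreteH1 G M) :
    ContinuousCohomology.map θ f 1 c = 0 ↔ ResKernel.resSubgroup θ.toMonoidHom.range M c = 0 := by
  obtain ⟨φ, rfl⟩ := oneCocycleClass_surjective _ c
  rw [map_oneCocycleClass_eq_zero_iff _ Y θ f hf, resSubgroup_oneCocycleClass_eq_zero_iff]
  constructor
  · rintro ⟨x, hx⟩
    refine ⟨x, ?_⟩
    rintro _ ⟨l, rfl⟩
    exact hx l
  · rintro ⟨x, hx⟩
    exact ⟨x, fun l ↦ hx (θ l) ⟨l, rfl⟩⟩

omit [IsTopologicalGroup G] in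
/-- The range of the inclusion `D ↪ G` is `D`. [folklore] -/
theorem range_subgroupIncl (D : Subgroup G) : Set.range (subgroupIncl D) = (D : Set G) := by
  ext g
  constructor
  · rintro ⟨x, rfl⟩
    exact x.2
  · intro hg
    exact ⟨⟨g, hg⟩, rfl⟩

/-- Restrictions to two subgroups with the same elements have the same kernel (e.g. `⊤ ⊓ D` and
`D`). Serre, *Galois Cohomology*, I.§2.5. [folklore] -/
theorem resSubgroup_eq_zero_iff_of_coe_eq {D D' : Subgroup G} (hDD' : (D : Set G) = D')
    (c : discreteH1 G M) :
    ResKernel.resSubgroup D M c = 0 ↔ ResKernel.resSubgroup D' M c = 0 :=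
  resH1Hom_eq_zero_iff_of_range_eq (subgroupIncl D) (AddMonoidHom.id M) (fun _ _ ↦ rfl)
    Function.bijective_id (subgroupIncl D') (AddMonoidHom.id M) (fun _ _ ↦ rfl)
    Function.bijective_id (by rw [range_subgroupIncl, range_subgroupIncl, hDD']) c

end Discrete

/-! ## §2. A `DistribMulAction` of `Γ_K` with open stabilisers as a `DiscreteGaloisModule` -/

section OfSMul

variable {K : Type u} [Field K]
variable (M : Type u) [AddCommGroup M] [DistribMulAction (absoluteGaloisGroup K) M]

/-- The `ℤ`-linear representation of `Γ_K` underlying a `DistribMulAction` on `M`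
(`σ ↦ (m ↦ σ • m)`), as in `WeierstrassCurve.torsionGaloisRepresentation`.
Serre, *Galois Cohomology*, II.§1.1. [folklore] -/
def smulRepresentation : Representation ℤ (absoluteGaloisGroup K) M where
  toFun σ := (DistribSMul.toAddMonoidHom M σ).toIntLinearMap
  map_one' := by ext m; simp
  map_mul' σ τ := by ext m; simp [mul_smul]

/-- Unfolding `smulRepresentation`: `ρ σ m = σ • m`. [folklore] -/
@[simp]
theorem smulRepresentation_apply_apply (σ : absoluteGaloisGroup K) (m : M) :
    smulRepresentation M σ m = σ • m :=
  rfl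

variable [TopologicalSpace M] [DiscreteTopology M]

/-- **The discrete `Γ_K`-module structure `ofSMul M hM` of a `DistribMulAction` with open
stabilisers** (`DiscreteGaloisModule.ofIsOpenStabilizer`).  Its Galois cohomology
`galoisCohomology (ofSMul M hM) n` is Mathlib's `continuousCohomology n (discreteTopRep Γ_K M)`,
DEFINITIONALLY (`toTopRep_ofSMul`), so that theorems of the `GaloisRepresentations` library apply to
the classes of the `GreenbergSelmer`/`SubgroupSelmer` library without transport.
Serre, *Galois Cohomology*, I.§2.1 and II.§1.1. [folklore] -/
def ofSMul (hM : ∀ m : M, IsOpen {σ : absoluteGaloisGroup K | σ • m = m}) :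
    DiscreteGaloisModule K M :=
  DiscreteGaloisModule.ofIsOpenStabilizer (smulRepresentation M) fun m ↦ by
    simpa only [smulRepresentation_apply_apply] using hM m

variable {M}

/-- Unfolding `ofSMul`: `ρ σ m = σ • m`. [folklore] -/
@[simp]
theorem ofSMul_apply_apply (hM : ∀ m : M, IsOpen {σ : absoluteGaloisGroup K | σ • m = m})
    (σ : absoluteGaloisGroup K) (m : M) : ofSMul M hM σ m = σ • m :=
  rfl

/-- The `TopRep` underlying `ofSMul M hM` is `discreteTopRep Γ_K M` (definitionally). [folklore] -/
theorem toTopRep_ofSMul (hM : ∀ m : M, IsOpen {σ : absoluteGaloisGroup K | σ • m = m}) :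
    (ofSMul M hM).toTopRep = discreteTopRep (absoluteGaloisGroup K) M :=
  rfl

/-- `Hⁿ(K, M)` of `ofSMul M hM` is `continuousCohomology n (discreteTopRep Γ_K M)`; in degree one
this is the type `discreteH1 Γ_K M` of the `GreenbergSelmer`/`SubgroupSelmer` library
(definitionally). [folklore] -/
theorem galoisCohomology_ofSMul_one (hM : ∀ m : M, IsOpen {σ : absoluteGaloisGroup K | σ • m = m}) :
    galoisCohomology (ofSMul M hM) 1 = discreteH1 (absoluteGaloisGroup K) M :=
  rfl

/-- **The identity `H¹(K, M) = H¹_cont(Γ_K, M)` as an additive isomorphism** between the type of the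
`GaloisRepresentations` library and the type of the `GreenbergSelmer` library (the two are
definitionally equal, `galoisCohomology_ofSMul_one`; this packages `AddEquiv.refl` across the
definitional unfolding so that statements mixing the two libraries stay instance-transparent).
[folklore] -/
def toDiscreteH1 (hM : ∀ m : M, IsOpen {σ : absoluteGaloisGroup K | σ • m = m}) :
    galoisCohomology (ofSMul M hM) 1 ≃+ discreteH1 (absoluteGaloisGroup K) M :=
  AddEquiv.refl _

/-- `toDiscreteH1` is the identity function. [folklore] -/
theorem toDiscreteH1_apply (hM : ∀ m : M, IsOpen {σ : absoluteGaloisGroup K | σ • m = m})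
    (c : galoisCohomology (ofSMul M hM) 1) :
    toDiscreteH1 hM c = (c : discreteH1 (absoluteGaloisGroup K) M) :=
  rfl

/-- The stabilisers of the `n`-torsion points `E[n]` are open. [folklore] -/
theorem isOpen_stabilizer_geomTorsion' (W : WeierstrassCurve K) (n : ℤ) (P : W.geomTorsion n) :
    IsOpen {σ : absoluteGaloisGroup K | σ • P = P} :=
  W.isOpen_stabilizer_geomTorsion n P

/-- `W.torsionGaloisModule n` (`GeomPointsGaloisModule`) IS `ofSMul E[n] _` (definitionally), so
every statement below about `ofSMul` applies verbatim to `E[n]`. [folklore] -/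
theorem torsionGaloisModule_eq_ofSMul (W : WeierstrassCurve K) (n : ℤ) :
    W.torsionGaloisModule n = ofSMul (W.geomTorsion n) (isOpen_stabilizer_geomTorsion' W n) :=
  rfl

/-- The stabilisers of the points of `E[p^∞]` are open (the orbit map is continuous,
`continuous_smul_geomPrimaryTorsion`, into a discrete space). [folklore] -/
theorem isOpen_stabilizer_geomPrimaryTorsion (W : WeierstrassCurve K) (p : ℕ)
    (P : W.geomPrimaryTorsion p) : IsOpen {σ : absoluteGaloisGroup K | σ • P = P} :=
  (isOpen_discrete ({P} : Set (W.geomPrimaryTorsion p))).preimage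
    (W.continuous_smul_geomPrimaryTorsion p P)

/-- **`E[p^∞]` as a discrete Galois module** over `K`: `ofSMul` for the `Γ_K`-action on the
`p`-primary torsion `geomPrimaryTorsion W p` (the coefficient module of route R1's Selmer groups;
`galoisCohomology (primaryGaloisModule W p) 1 = W.galH1Primary p` definitionally).
Greenberg (1999), §2; Serre, *Galois Cohomology*, II.§1.1. [folklore] -/
def primaryGaloisModule (W : WeierstrassCurve K) (p : ℕ) :
    DiscreteGaloisModule K (W.geomPrimaryTorsion p) :=
  ofSMul (W.geomPrimaryTorsion p) (isOpen_stabilizer_geomPrimaryTorsion W p)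

/-- `H¹(K, E[p^∞])` of `primaryGaloisModule` is `W.galH1Primary p = discreteH1 Γ_K E[p^∞]`
(definitionally). [folklore] -/
theorem galoisCohomology_primaryGaloisModule_one (W : WeierstrassCurve K) (p : ℕ) :
    galoisCohomology (primaryGaloisModule W p) 1 = W.galH1Primary p :=
  rfl

end OfSMul

/-! ## §3. `loc_v c = 0` in `H¹(K_v, M)` iff `res_{D_v} c = 0` -/

section Localization

variable {K : Type u} [Field K]
variable {M : Type u} [AddCommGroup M] [DistribMulAction (absoluteGaloisGroup K) M]
  [TopologicalSpace M] [DiscreteTopology M]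
  (hM : ∀ m : M, IsOpen {σ : absoluteGaloisGroup K | σ • m = m})

/-- The restriction `res : H¹(K, M) → H¹(E, M)` of the `GaloisRepresentations` library along
`absGaloisRestrict K E` kills a class iff restriction to the SUBGROUP `range (Γ_E → Γ_K) ≤ Γ_K`
kills it (`map_eq_zero_iff_resSubgroup_range`: the pull-back is along a pair bijective — the
identity — on coefficients). Serre, *Galois Cohomology*, I.§2.4–2.5, II.§1.1. [folklore] -/
theorem res_ofSMul_eq_zero_iff (E : Type u) [Field E] [Algebra K E]
    (c : galoisCohomology (ofSMul M hM) 1) :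
    galoisCohomology.res (ofSMul M hM) E 1 c = 0 ↔
      ResKernel.resSubgroup (absGaloisRestrict K E).toMonoidHom.range M (toDiscreteH1 hM c) = 0 :=
  map_eq_zero_iff_resSubgroup_range (absGaloisRestrict K E) _ _ Function.bijective_id c

variable [NumberField K]

/-- **Finite places: `loc_v c = 0` in `H¹(K_v, M) = H¹(Γ_{K_v}, M)` iff `c` dies on the
decomposition group `D_v = GreenbergSelmer.decomp v ≤ Γ_K`** (`D_v` is by definition the range of
`Γ_{K_v} → Γ_K`; inflation along the surjection `Γ_{K_v} ↠ D_v` is injective on `H¹`).  This is the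
identification "`G_{M_η}` … is just the decomposition subgroup for some prime of `F̄` lying over
`η`" used to define Selmer groups in Greenberg (1999), §2, made a theorem for locally-trivial
conditions. [cite: GreenbergLNM1716, §2] -/
theorem localization_inr_eq_zero_iff (v : HeightOneSpectrum (𝓞 K))
    (c : galoisCohomology (ofSMul M hM) 1) :
    galoisCohomology.localization (ofSMul M hM) (Sum.inr v) 1 c = 0 ↔
      ResKernel.resSubgroup (decomp v) M (toDiscreteH1 hM c) = 0 :=
  res_ofSMul_eq_zero_iff hM (v.adicCompletion K) c

/-- Infinite places: `loc_w c = 0` in `H¹(K_w, M)` iff `c` dies on `decompInf w ≤ Γ_K`.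
[cite: Greenberg1989, §1 p. 98 ("including the infinite places")] -/
theorem localization_inl_eq_zero_iff (w : InfinitePlace K)
    (c : galoisCohomology (ofSMul M hM) 1) :
    galoisCohomology.localization (ofSMul M hM) (Sum.inl w) 1 c = 0 ↔
      ResKernel.resSubgroup (decompInf w) M (toDiscreteH1 hM c) = 0 :=
  res_ofSMul_eq_zero_iff hM w.Completion c

end Localization

end Summit.BirchSwinnertonDyer.Rank1Residual.X11b.LocBridge

end
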